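import Literature.Probability.FitznerVanDerHofstad2017.NobleGapSliceSymm
import Literature.Probability.FitznerVanDerHofstad2017.NobleExactLegSlotsRowTwo
import HarnessLib

/-!
# [FvdH17] §5.1 p. 49 / App. B p. 78 / §6.1 p. 59 — the AVERAGED double-open elements of the column `b = 1`:
`(Ā^ι_avg)_{a,1} ≤ (|U| · p)⁻¹ · (A^ι)_{a,1}` (any letter table), and the cells `(1,1)`, `(2,1)` for `Letters.perc d p`

Source: R. Fitzner, R. van der Hofstad, *Mean-field behavior for nearest-neighbor percolation in `d > 10`*,
Electron. J. Probab. **22** (2017) no. 43 [FvdH17]; extended version arXiv:1506.07977v2: §5.1 "Elements of the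
bounds" (p. 49) `(A^ι)_{a,b} = sup_v Σ_{ι,x,y} A^{ι,a,b}(0,v,x,y)`, `(Ā^ι)_{a,b} = sup_{v,y} Σ_{ι,x} Ā^{ι,a,b}(0,v,x,x+y)`;
App. B display "double-open triangle": `Ā^{ι,a,1} = (1/p) A^{ι,a,1}` for `a = 0, 1, 2` (p. 78); §6.1 p. 59 "When
`a = 1` and/or `b = 1`, we include the information that either `u, w` and/or `z, t` are neighbors"; the companion
Mathematica notebook of the `d = 11` verification (`Percolation.nb`, cell defining `Bound[AiotaBar,a,1,s]`):
`Bound[AiotaBar,a,1,s] = Bound[Aiota,a,1,s]/(2d z[s])` for `a = 1, 2` — the class-`1` out-offset AVERAGED over its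
`2d` unit values.  The EXL-XSLOT cells of `(A^ι)_{1,1}`, `(A^ι)_{2,1}` are R. Fitzner, R. van der Hofstad,
*Generalized approach to the non-backtracking lace expansion*, Probab. Theory Relat. Fields **169** (2017) §5.3.2
(5.40) [FitznerVanDerHofstad2016NoBLE], landed as `NobleExactLegSlotsSquare` / `NobleExactLegSlotsRowTwo`.

## What this module proves (kernel-checked; no cited hypothesis; no dimension and no numerical value appears)

Write `G_a(v,y) := Σ_x Σ_κ A^{κ,a,1}(0,v,x,x+y)` for the gap slice of the `κ`-summed block of the column `b = 1`
(`blockAiota`, base point `0`), so that `(A^ι)_{a,1} = sup_v Σ_y G_a(v,y)` (`matAiota_apply_gap`) and, pointwise,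
`Ā^{κ,a,1}(0,v,x,y) = p⁻¹ A^{κ,a,1}(0,v,x,y)` (`blockAbar_col_one`).  For the AVERAGED double-open matrix
`matAbarAvg U avg A` of `BlockSummationAvg` (class map `avg`, finite set `U` of class-`1` offsets) and ANY block
family `A` agreeing with `blockAbar L` on the entry `(a,1)` (the landed `blockAbar`, the primed `blockAbar'` of
`NobleBlocksPrime`, the `§6.1`-typed `blockAbar''` of `NobleBlocksDoublePrime` — all three coincide on the column
`b = 1`):

* §A (any letter table `L`, any `U`): the out-gap average is a finite SUB-SUM of the full gap sum and an in-gap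
  average never exceeds the in-gap supremum, hence in both shapes of the column — `(sup_v, avg_y)` (`avg a = false`)
  and `(avg_v, avg_y)` (`avg a = true`) —
  **`matAbarAvg U avg A a 1 ≤ |U|⁻¹ · p⁻¹ · (A^ι)_{a,1}`** (`matAbarAvg_col_one_le_of_eq_false`, `…_of_eq_true`).
  No symmetry of the letters is used (contrast `NobleGapSliceSymm`, where the row `a = 0` gives an IDENTITY).
* §B (`L = Letters.perc d p`, `U = unitVecs d` the `2d` unit vectors, `2 ≤ d`, `p < p_I(d)`): composed with the landed
  EXL-XSLOT producers `perc_matAiota_one_one_le_xslot` and `perc_matAiota_two_one_le_xslot(₃)`, the notebook cells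
  **`(Ā^ι_avg)_{1,1} ≤ ((2d)·p)⁻¹ · bubbleSlotR p Γ̄₂ 1 1 M N R₁ R₂`** and
  **`(Ā^ι_avg)_{2,1} ≤ ((2d)·p)⁻¹ · bubbleSlotR …`** (one class, or the three endpoint classes `{0}` / odd / even `≠ 0`)
  — `Bound[AiotaBar,a,1] = Bound[Aiota,a,1]/(2d z)` in slot currency, for every family `A` as above; and the
  named forms for the primed family at the class map `a ↦ (a = 1)` (nodes N76-AVG11 / N76-AVG21 of the cell's map):
  `perc_matAbarAvg'_one_one_le`, `perc_matAbarAvg'_two_one_le` (`≤ ((2d)·p)⁻¹ · (A^ι)_{a,1}`, any `d`, any `p`) and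
  their consumer forms `…_of_matAiota_le` (from any `(A^ι)_{a,1} ≤ ofReal B`), as in `NobleGapSliceSymm` §E for `(0,1)`.

All statements are unconditional theorems about the landed definitions; nothing is cited as a hypothesis; no `def`.
-/

noncomputable section

namespace Literature.Probability.FitznerVanDerHofstad2017.NobleBlocks

open _root_.MeasureTheory Literature.Probability.LatticeModels Literature.Probability.Percolation
open Literature.Probability.FitznerVanDerHofstad2017.NobleBlocks.LenIdx
open Literature.Probability.FitznerVanDerHofstad2017.BlockSummation
open Literature.Barriers.CriticalPhenomena (nobleSup2)
open scoped BigOperators ENNReal Matrix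

variable {d : ℕ}

/-! ## A. The column `b = 1` of the averaged double-open matrix, any letter table -/

section Generic

variable (L : Letters d)

/-- The gap slice of a family agreeing with `Ā` on `(a,1)`: `Σ_x Σ_κ A^{κ}(0,v,x,x+y) = p⁻¹ · G_a(v,y)`
(`Ā^{ι,a,1} = (1/p) A^{ι,a,1}` pointwise).
[cite: FitznerVanDerHofstad2017, App. B, display "double-open triangle Ā^{ι,a,b}", line Ā^{ι,a,1} = (1/p) A^{ι,a,1} (arXiv:1506.07977v2 p. 78)] -/
theorem openGap_sum_col_one_eq {A : Fin d × Bool → Fin 3 → Fin 3 → Site d → Site d → Site d → Site d → ℝ≥0∞}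
    {a : Fin 3} (hcol : ∀ κ, A κ a 1 = blockAbar L κ a 1) (v y : Site d) :
    openGap (fun u w x z => ∑ κ, A κ a 1 u w x z) v y = L.p⁻¹ * ∑' x, ∑ κ, blockAiota L κ a 1 0 v x (x + y) := by
  simp only [openGap, hcol, blockAbar_col_one, ← Finset.mul_sum, ENNReal.tsum_mul_left]

/-- **The out-gap average is a sub-sum, the in-gap average is below the supremum**:
`sup_v |U|⁻¹ Σ_{y∈U} Σ_x Σ_κ A^{κ}(0,v,x,x+y) ≤ |U|⁻¹ · p⁻¹ · (A^ι)_{a,1}` for a family agreeing with `Ā` on `(a,1)`.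
[cite: FitznerVanDerHofstad2017, §5.1 "Elements of the bounds" (arXiv:1506.07977v2 p. 49) with §6.1 p. 59 "we include the information that … z, t are neighbors"; App. B (p. 78)] -/
theorem iSup_avgOn_openGap_col_one_le (U : Finset (Site d))
    {A : Fin d × Bool → Fin 3 → Fin 3 → Site d → Site d → Site d → Site d → ℝ≥0∞} {a : Fin 3}
    (hcol : ∀ κ, A κ a 1 = blockAbar L κ a 1) :
    (⨆ v, avgOn U (fun y => openGap (fun u w x z => ∑ κ, A κ a 1 u w x z) v y)) ≤
      (U.card : ℝ≥0∞)⁻¹ * L.p⁻¹ * matAiota L a 1 := by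
  rw [matAiota_apply_gap, mul_assoc, ENNReal.mul_iSup, ENNReal.mul_iSup]
  refine iSup_mono fun v => ?_
  have hslice : (fun y => openGap (fun u w x z => ∑ κ, A κ a 1 u w x z) v y) =
      fun y => L.p⁻¹ * ∑' x, ∑ κ, blockAiota L κ a 1 0 v x (x + y) := funext (openGap_sum_col_one_eq L hcol v)
  rw [hslice, avgOn_const_mul, avgOn_def, mul_left_comm]
  gcongr
  exact ENNReal.sum_le_tsum _

/-- **Column `b = 1`, shape `(sup_v, avg_y)`** (`avg a = false`, `avg 1 = true`; e.g. the row `a = 2`):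
`matAbarAvg U avg A a 1 ≤ |U|⁻¹ · p⁻¹ · (A^ι)_{a,1}` for every family `A` agreeing with `blockAbar L` on `(a,1)`.
[cite: FitznerVanDerHofstad2017, §5.1 "Elements of the bounds" (arXiv:1506.07977v2 p. 49) with §6.1 p. 59; App. B display "Ā^{ι,a,1} = (1/p) A^{ι,a,1}" (p. 78)] -/
theorem matAbarAvg_col_one_le_of_eq_false (U : Finset (Site d)) {avg : Fin 3 → Bool} {a : Fin 3}
    (ha : avg a = false) (h1 : avg 1 = true)
    {A : Fin d × Bool → Fin 3 → Fin 3 → Site d → Site d → Site d → Site d → ℝ≥0∞}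
    (hcol : ∀ κ, A κ a 1 = blockAbar L κ a 1) :
    matAbarAvg U avg A a 1 ≤ (U.card : ℝ≥0∞)⁻¹ * L.p⁻¹ * matAiota L a 1 := by
  rw [matAbarAvg_apply, ha, h1, normOOavg_false_true]
  exact iSup_avgOn_openGap_col_one_le L U hcol

/-- **Column `b = 1`, shape `(avg_v, avg_y)`** (`avg a = true`, `avg 1 = true`; the entry `(1,1)`):
`matAbarAvg U avg A a 1 ≤ |U|⁻¹ · p⁻¹ · (A^ι)_{a,1}` for every family `A` agreeing with `blockAbar L` on `(a,1)`.
[cite: FitznerVanDerHofstad2017, §5.1 "Elements of the bounds" (arXiv:1506.07977v2 p. 49) with §6.1 p. 59 "either u, w and/or z, t are neighbors"; App. B display "Ā^{ι,a,1} = (1/p) A^{ι,a,1}" (p. 78)] -/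
theorem matAbarAvg_col_one_le_of_eq_true (U : Finset (Site d)) {avg : Fin 3 → Bool} {a : Fin 3}
    (ha : avg a = true) (h1 : avg 1 = true)
    {A : Fin d × Bool → Fin 3 → Fin 3 → Site d → Site d → Site d → Site d → ℝ≥0∞}
    (hcol : ∀ κ, A κ a 1 = blockAbar L κ a 1) :
    matAbarAvg U avg A a 1 ≤ (U.card : ℝ≥0∞)⁻¹ * L.p⁻¹ * matAiota L a 1 := by
  rw [matAbarAvg_apply, ha, h1, normOOavg_true_true]
  exact (avgOn_le_iSup U _).trans (iSup_avgOn_openGap_col_one_le L U hcol)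

/-- The landed family at `(1,1)`: `matAbarAvg U avg (blockAbar L) 1 1 ≤ |U|⁻¹ · p⁻¹ · (A^ι)_{1,1}` (`avg 1 = true`).
[cite: FitznerVanDerHofstad2017, §5.1 "Elements of the bounds" (arXiv:1506.07977v2 p. 49) with §6.1 p. 59; App. B (p. 78)] -/
theorem matAbarAvg_blockAbar_one_one_le (U : Finset (Site d)) {avg : Fin 3 → Bool} (h1 : avg 1 = true) :
    matAbarAvg U avg (blockAbar L) 1 1 ≤ (U.card : ℝ≥0∞)⁻¹ * L.p⁻¹ * matAiota L 1 1 :=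
  matAbarAvg_col_one_le_of_eq_true L U h1 h1 fun _ => rfl

/-- The landed family at `(2,1)`: `matAbarAvg U avg (blockAbar L) 2 1 ≤ |U|⁻¹ · p⁻¹ · (A^ι)_{2,1}`
(`avg 2 = false`, `avg 1 = true`).
[cite: FitznerVanDerHofstad2017, §5.1 "Elements of the bounds" (arXiv:1506.07977v2 p. 49) with §6.1 p. 59; App. B (p. 78)] -/
theorem matAbarAvg_blockAbar_two_one_le (U : Finset (Site d)) {avg : Fin 3 → Bool} (h2 : avg 2 = false)
    (h1 : avg 1 = true) :
    matAbarAvg U avg (blockAbar L) 2 1 ≤ (U.card : ℝ≥0∞)⁻¹ * L.p⁻¹ * matAiota L 2 1 :=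
  matAbarAvg_col_one_le_of_eq_false L U h2 h1 fun _ => rfl

/-- The primed family agrees with the landed one on the column `b = 1`.
[cite: FitznerVanDerHofstad2017, App. B display "double-open triangle Ā^{ι,a,b}" (arXiv:1506.07977v2 p. 78)] -/
theorem blockAbar'_col_one (κ : Fin d × Bool) (a : Fin 3) : blockAbar' L κ a 1 = blockAbar L κ a 1 :=
  blockAbar'_of_ne L κ fun h => absurd h.2 (by decide)

end Generic

/-! ## B. The cells `(1,1)` and `(2,1)` for the percolation letters, class `1` averaged over the `2d` unit vectors -/

section Cells

variable (p : unitInterval)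

/-- `|unitVecs d|⁻¹ · p⁻¹ = ((2d)·p)⁻¹` at `Letters.perc d p` (the notebook's `1/(2d z)`).
[cite: FitznerVanDerHofstad2017, §6.1 p. 59 with §5.1 "Elements of the bounds" (arXiv:1506.07977v2 p. 49)] -/
private theorem card_unitVecs_inv_mul_perc_p_inv :
    ((unitVecs d).card : ℝ≥0∞)⁻¹ * (Letters.perc d p).p⁻¹ = ((2 * d : ℝ≥0∞) * ENNReal.ofReal p)⁻¹ := by
  rw [card_unitVecs, perc_p, ENNReal.mul_inv (Or.inr ENNReal.ofReal_ne_top)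
    (Or.inl (ENNReal.mul_ne_top (by simp) (ENNReal.natCast_ne_top d)))]
  push_cast
  rfl

/-- **N76-AVG11, the primed family at the class map `a ↦ (a = 1)`**: `(Ā'^ι_avg)_{1,1} ≤ ((2d)·p)⁻¹ · (A^ι)_{1,1}` at
`Letters.perc d p` (any `d`, any `p`; cell 19 = `Bound[Aiota,1,1]/(2d z)`).
[cite: FitznerVanDerHofstad2017, §5.1 "Elements of the bounds" (arXiv:1506.07977v2 p. 49) with §6.1 p. 59; App. B display "Ā^{ι,a,1} = (1/p) A^{ι,a,1}" (p. 78)] -/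
theorem perc_matAbarAvg'_one_one_le :
    matAbarAvg (unitVecs d) (fun a : Fin 3 => decide (a = 1)) (blockAbar' (Letters.perc d p)) 1 1 ≤
      ((2 * d : ℝ≥0∞) * ENNReal.ofReal (p : ℝ))⁻¹ * matAiota (Letters.perc d p) 1 1 := by
  rw [← card_unitVecs_inv_mul_perc_p_inv]
  exact matAbarAvg_col_one_le_of_eq_true _ _ rfl rfl (blockAbar'_col_one _ · 1)

/-- **N76-AVG21, the primed family at the class map `a ↦ (a = 1)`**: `(Ā'^ι_avg)_{2,1} ≤ ((2d)·p)⁻¹ · (A^ι)_{2,1}` at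
`Letters.perc d p` (any `d`, any `p`; cell 20 = `Bound[Aiota,2,1]/(2d z)`).
[cite: FitznerVanDerHofstad2017, §5.1 "Elements of the bounds" (arXiv:1506.07977v2 p. 49) with §6.1 p. 59; App. B display "Ā^{ι,a,1} = (1/p) A^{ι,a,1}" (p. 78)] -/
theorem perc_matAbarAvg'_two_one_le :
    matAbarAvg (unitVecs d) (fun a : Fin 3 => decide (a = 1)) (blockAbar' (Letters.perc d p)) 2 1 ≤
      ((2 * d : ℝ≥0∞) * ENNReal.ofReal (p : ℝ))⁻¹ * matAiota (Letters.perc d p) 2 1 := by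
  rw [← card_unitVecs_inv_mul_perc_p_inv]
  exact matAbarAvg_col_one_le_of_eq_false _ _ rfl rfl (blockAbar'_col_one _ · 2)

/-- Consumer form of N76-AVG11: from ANY bound `(A^ι)_{1,1} ≤ ofReal B`,
`(Ā'^ι_avg)_{1,1} ≤ ((2d)·p)⁻¹ · ofReal B`.
[cite: FitznerVanDerHofstad2017, §5.1 "Elements of the bounds" (arXiv:1506.07977v2 p. 49) with §6.1 p. 59; App. B (p. 78)] -/
theorem perc_matAbarAvg'_one_one_le_of_matAiota_le {B : ℝ} (hA : matAiota (Letters.perc d p) 1 1 ≤ ENNReal.ofReal B) :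
    matAbarAvg (unitVecs d) (fun a : Fin 3 => decide (a = 1)) (blockAbar' (Letters.perc d p)) 1 1 ≤
      ((2 * d : ℝ≥0∞) * ENNReal.ofReal (p : ℝ))⁻¹ * ENNReal.ofReal B :=
  (perc_matAbarAvg'_one_one_le p).trans (by gcongr)

/-- Consumer form of N76-AVG21: from ANY bound `(A^ι)_{2,1} ≤ ofReal B`,
`(Ā'^ι_avg)_{2,1} ≤ ((2d)·p)⁻¹ · ofReal B`.
[cite: FitznerVanDerHofstad2017, §5.1 "Elements of the bounds" (arXiv:1506.07977v2 p. 49) with §6.1 p. 59; App. B (p. 78)] -/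
theorem perc_matAbarAvg'_two_one_le_of_matAiota_le {B : ℝ} (hA : matAiota (Letters.perc d p) 2 1 ≤ ENNReal.ofReal B) :
    matAbarAvg (unitVecs d) (fun a : Fin 3 => decide (a = 1)) (blockAbar' (Letters.perc d p)) 2 1 ≤
      ((2 * d : ℝ≥0∞) * ENNReal.ofReal (p : ℝ))⁻¹ * ENNReal.ofReal B :=
  (perc_matAbarAvg'_two_one_le p).trans (by gcongr)

/-- **Cell `(1,1)`** (`Bound[AiotaBar,1,1] = Bound[Aiota,1,1]/(2d z)`): for every family `A` agreeing with
`blockAbar (Letters.perc d p)` on `(1,1)` and every class map with `avg 1 = true`,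
`matAbarAvg (unitVecs d) avg A 1 1 ≤ ((2d)·p)⁻¹ · bubbleSlotR p Γ̄₂ 1 1 M N R₁ R₂` (`N` majorises the trail-word counts
to `e_{ι₀}`, `R₁` valid for `[M]`, `R₂` for `[M−1, 1]` on a set containing `e_{ι₀}`; `2 ≤ M`, `2 ≤ d`, `p < p_I`).
[cite: FitznerVanDerHofstad2017, §5.1 "Elements of the bounds" (arXiv:1506.07977v2 p. 49) with §6.1 p. 59; App. B Table B.4 row (1,1) (p. 74) and display "Ā^{ι,a,1} = (1/p) A^{ι,a,1}" (p. 78)]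
[cite: FitznerVanDerHofstad2016NoBLE, §5.3.2 (5.40) (PTRF 169 (2017) p. 1098)] -/
theorem perc_matAbarAvg_one_one_le_xslot (hd : 2 ≤ d) (hp : p < criticalProbI d) {M : ℕ} (hM : 2 ≤ M)
    (ι₀ : Fin d × Bool) {X : Set (Site d)} (hι : (stepVec ι₀ : Site d) ∈ X) {N : ℕ → ℕ}
    (hN : ∀ L, (trailWordsTo d L (stepVec ι₀ : Site d)).card ≤ N L) {R₁ R₂ : ℝ}
    (hR₁ : IsRemKernelConst d [M] X R₁) (hR₂ : IsRemKernelConst d [M - 1, 1] X R₂)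
    {avg : Fin 3 → Bool} (h1 : avg 1 = true)
    {A : Fin d × Bool → Fin 3 → Fin 3 → Site d → Site d → Site d → Site d → ℝ≥0∞}
    (hcol : ∀ κ, A κ 1 1 = blockAbar (Letters.perc d p) κ 1 1) :
    matAbarAvg (unitVecs d) avg A 1 1 ≤
      ((2 * d : ℝ≥0∞) * ENNReal.ofReal p)⁻¹ * ENNReal.ofReal (bubbleSlotR p (nobleSup2 d p) 1 1 M N R₁ R₂) := by
  refine (matAbarAvg_col_one_le_of_eq_true (Letters.perc d p) (unitVecs d) h1 h1 hcol).trans ?_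
  rw [card_unitVecs_inv_mul_perc_p_inv]
  gcongr
  exact perc_matAiota_one_one_le_xslot p hd hp hM ι₀ hι hN hR₁ hR₂

/-- **Cell `(2,1)`, one endpoint class** (`Bound[AiotaBar,2,1] = Bound[Aiota,2,1]/(2d z)`): for every family `A`
agreeing with `blockAbar (Letters.perc d p)` on `(2,1)` and every class map with `avg 2 = false`, `avg 1 = true`,
`matAbarAvg (unitVecs d) avg A 2 1 ≤ ((2d)·p)⁻¹ · bubbleSlotR p Γ̄₂ 1 1 M N R₁ R₂` (`N` valid at every endpoint,
constants on `ℤ^d`; `2 ≤ M`, `2 ≤ d`, `p < p_I`).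
[cite: FitznerVanDerHofstad2017, §5.1 "Elements of the bounds" (arXiv:1506.07977v2 p. 49) with §6.1 p. 59; App. B Table B.4 row (2,1) (p. 75) and display "Ā^{ι,a,1} = (1/p) A^{ι,a,1}" (p. 78)]
[cite: FitznerVanDerHofstad2016NoBLE, §5.3.2 (5.40) (PTRF 169 (2017) p. 1098)] -/
theorem perc_matAbarAvg_two_one_le_xslot (hd : 2 ≤ d) (hp : p < criticalProbI d) {M : ℕ} (hM : 2 ≤ M)
    {N : ℕ → ℕ} (hN : ∀ L (v : Site d), (trailWordsTo d L v).card ≤ N L) {R₁ R₂ : ℝ}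
    (hR₁ : IsRemKernelConst d [M] (Set.univ : Set (Site d)) R₁)
    (hR₂ : IsRemKernelConst d [M - 1, 1] (Set.univ : Set (Site d)) R₂)
    {avg : Fin 3 → Bool} (h2 : avg 2 = false) (h1 : avg 1 = true)
    {A : Fin d × Bool → Fin 3 → Fin 3 → Site d → Site d → Site d → Site d → ℝ≥0∞}
    (hcol : ∀ κ, A κ 2 1 = blockAbar (Letters.perc d p) κ 2 1) :
    matAbarAvg (unitVecs d) avg A 2 1 ≤
      ((2 * d : ℝ≥0∞) * ENNReal.ofReal p)⁻¹ * ENNReal.ofReal (bubbleSlotR p (nobleSup2 d p) 1 1 M N R₁ R₂) := by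
  refine (matAbarAvg_col_one_le_of_eq_false (Letters.perc d p) (unitVecs d) h2 h1 hcol).trans ?_
  rw [card_unitVecs_inv_mul_perc_p_inv]
  gcongr
  exact perc_matAiota_two_one_le_xslot p hd hp hM hN hR₁ hR₂

/-- **Cell `(2,1)`, endpoint classes** `{0}` / odd / even `≠ 0` (one order `M_c ≥ 2` and one count majorant per class):
`matAbarAvg (unitVecs d) avg A 2 1 ≤ ((2d)·p)⁻¹ · max (bubbleSlotR … M₀ N₀ A₁ A₂) (max (… M₁ N₁ B₁ B₂) (… M₂ N₂ C₁ C₂))`.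
[cite: FitznerVanDerHofstad2017, §5.1 "Elements of the bounds" and (5.6) (arXiv:1506.07977v2 p. 49) with §6.1 p. 59; App. B Table B.4 row (2,1) (p. 75) and display "Ā^{ι,a,1} = (1/p) A^{ι,a,1}" (p. 78)]
[cite: FitznerVanDerHofstad2016NoBLE, §5.3.2 (5.40) (PTRF 169 (2017) p. 1098)] -/
theorem perc_matAbarAvg_two_one_le_xslot₃ (hd : 2 ≤ d) (hp : p < criticalProbI d)
    {M₀ M₁ M₂ : ℕ} (hM₀ : 2 ≤ M₀) (hM₁ : 2 ≤ M₁) (hM₂ : 2 ≤ M₂)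
    {N₀ N₁ N₂ : ℕ → ℕ} (hN₀ : ∀ L, (trailWordsTo d L (0 : Site d)).card ≤ N₀ L)
    (hN₁ : ∀ L (v : Site d), l1Norm v % 2 = 1 → (trailWordsTo d L v).card ≤ N₁ L)
    (hN₂ : ∀ L (v : Site d), v ≠ 0 → l1Norm v % 2 = 0 → (trailWordsTo d L v).card ≤ N₂ L)
    {A₁ A₂ B₁ B₂ C₁ C₂ : ℝ}
    (hA₁ : IsRemKernelConst d [M₀] ({0} : Set (Site d)) A₁)
    (hA₂ : IsRemKernelConst d [M₀ - 1, 1] ({0} : Set (Site d)) A₂)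
    (hB₁ : IsRemKernelConst d [M₁] {v : Site d | l1Norm v % 2 = 1} B₁)
    (hB₂ : IsRemKernelConst d [M₁ - 1, 1] {v : Site d | l1Norm v % 2 = 1} B₂)
    (hC₁ : IsRemKernelConst d [M₂] {v : Site d | v ≠ 0 ∧ l1Norm v % 2 = 0} C₁)
    (hC₂ : IsRemKernelConst d [M₂ - 1, 1] {v : Site d | v ≠ 0 ∧ l1Norm v % 2 = 0} C₂)
    {avg : Fin 3 → Bool} (h2 : avg 2 = false) (h1 : avg 1 = true)
    {A : Fin d × Bool → Fin 3 → Fin 3 → Site d → Site d → Site d → Site d → ℝ≥0∞}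
    (hcol : ∀ κ, A κ 2 1 = blockAbar (Letters.perc d p) κ 2 1) :
    matAbarAvg (unitVecs d) avg A 2 1 ≤ ((2 * d : ℝ≥0∞) * ENNReal.ofReal p)⁻¹ *
      ENNReal.ofReal (max (bubbleSlotR p (nobleSup2 d p) 1 1 M₀ N₀ A₁ A₂)
        (max (bubbleSlotR p (nobleSup2 d p) 1 1 M₁ N₁ B₁ B₂) (bubbleSlotR p (nobleSup2 d p) 1 1 M₂ N₂ C₁ C₂))) := by
  refine (matAbarAvg_col_one_le_of_eq_false (Letters.perc d p) (unitVecs d) h2 h1 hcol).trans ?_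
  rw [card_unitVecs_inv_mul_perc_p_inv]
  gcongr
  exact perc_matAiota_two_one_le_xslot₃ p hd hp hM₀ hM₁ hM₂ hN₀ hN₁ hN₂ hA₁ hA₂ hB₁ hB₂ hC₁ hC₂

end Cells

end Literature.Probability.FitznerVanDerHofstad2017.NobleBlocks
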